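import Summits.HodgeConjecture.HodgeConjecture.Theorems.HeckePrymWeilAimedDescendingFrame
import Summits.HodgeConjecture.HodgeConjecture.Theorems.HeckePrymWeilAimedDescendingProductLefschetz
import Literature.AlgebraicGeometry.HodgeTheory.AbelianVarietyEndomorphismsHOne
import Literature.AlgebraicGeometry.HodgeTheory.WeilClassesIsogenyDescent
import Literature.AlgebraicGeometry.Motives.AbelianVarietyProjectiveChart
import Literature.AlgebraicGeometry.Motives.AbelianVarietyProduct

/-!
# `AimedDescending` (stmt-HodgeConjecture-14643) · VI · the hyperbolic frame of a product from frames of the factors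

Route `HeckePrymWeil`, support item `AimedDescending`. The aiming lemma of the product trick
(`exists_cmWeilSurface_aimedSplitProduct_of_ne_one_of_ne_three`, file IV; Markman arXiv:2509.23403
§11.5 Step 2, van Geemen LNM 1594 Lemma 5.2 (2)–(3), 5.3, 5.4) says that the product `A × B` of a
Weil-type abelian variety with the aimed CM Weil surface is of HYPERBOLIC Weil type
(`Motives.IsHyperbolicWeilType`: a rational, `(φ × ψ)^*`-stable, Lagrangian `2N`-frame of
`H¹((A × B)(ℂ); ℂ)` for the polarization pairing `Q_h = h^{2N-1} ⌣ (· ⌣ ·)` of the product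
polarization class `h = pr_A^* h_A + pr_B^* h_B`). This file proves the CARRIER CORE of that
statement, for arbitrary complex abelian varieties `A`, `B` with endomorphisms `φ`, `ψ`:

* `linearIndependent_sumElim_map_fst_map_snd` — Künneth in degree one for the frame: pulling back
  `ℂ`-independent families from `A` and from `B` gives a `ℂ`-independent family on `A × B` (the
  sections `(𝟙, 0)`, `(0, 𝟙)` separate the two summands; `0^* = 0` on `H¹` is the tree's
  `complexBetti_map_zero_one`);
* `map_prodLift_map_fst` / `…_snd` — `(φ × ψ)^* pr_A^* = pr_A^* φ^*`, `(φ × ψ)^* pr_B^* = pr_B^* ψ^*`;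
* `isHyperbolicWeilType_prod_of_rationalModels` — **given rational degree-one models of
  `(A, φ, h_A)` and `(B, ψ, h_B)`** (rational frames `u`, `w` with rational matrices `M_A`, `M_B` of
  `φ^*`, `ψ^*`, rational Gram matrices `G_A`, `G_B` of `Q_{h_A}`, `Q_{h_B}` and top powers
  `h_A^{dim A} = d_A ω_A`, `h_B^{dim B} = d_B ω_B`) **and `2N` independent rational coefficient
  vectors spanning an `(M_A ⊕ M_B)`-stable subspace totally isotropic for the weighted orthogonal
  sum `C(2N-1, dim A - 1)·d_B·G_A ⊕ C(2N-1, dim A)·d_A·G_B`, the pair `(A × B, φ × ψ)` is of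
  hyperbolic Weil type in half-dimension `N` (`2N = dim A + dim B`) for `pr_A^* h_A + pr_B^* h_B`.**
  The block Gram matrix is file V (`polarizationPairingOne_add_map_map`, `…'`, `…_mixed`: van
  Geemen's "`det H` is multiplicative under products", Lemma 5.2 (3), in cohomological form); the
  frame transport is file II (`isHyperbolicWeilType_of_rationalModel`).

With this theorem the aiming lemma reduces to: (a) rational degree-one models of Weil-type abelian
varieties with the SIGNATURE of `G_A` (Hodge–Riemann in degree one; `H^• = ⋀^• H¹`,
`Motives.abelianVarietyCohomologyExteriorH1`), (b) the CM Weil surface `E₀ × E₀` with its model,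
(c) the hyperplane class of weighted Segre embeddings, and the PROVED arithmetic
`aimingArithmetic` (file III) supplying the isotropic vectors.
-/

noncomputable section

-- every declaration of this problem lives in `Summit.HodgeConjecture.HodgeConjecture.…`
set_option linter.dupNamespace false

open CategoryTheory
open Literature.AlgebraicGeometry Literature.AlgebraicGeometry.HodgeTheory
open Literature.AlgebraicTopology.SingularHomology
open Literature.Geometry.Kaehler

/-! ## VI · The hyperbolic frame of a product from frames of the factors -/

namespace Summit.HodgeConjecture.HodgeConjecture.Theorems

section Frame

open Literature.AlgebraicGeometry.Motives (AbelianVariety)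

variable {A B : Motives.AbelianVariety ℂ}

/-- The section `(𝟙, 0) : A ⟶ A × B` splits `pr_A^*` on `H¹`: `(𝟙, 0)^* pr_A^* x = x`. [folklore] -/
theorem map_inlSection_map_fst_one (x : complexBetti A.X 1) :
    complexBetti.map (AbelianVariety.prodLift (𝟙 A) (0 : A ⟶ B)).hom.hom.hom 1
        (complexBetti.map (AbelianVariety.fst A B).hom.hom.hom 1 x) = x := by
  change singularCohomology.map ℂ ℂ _ 1 (singularCohomology.map ℂ ℂ _ 1 x) = x
  rw [abelianVarietyHom_map_map_apply, AbelianVariety.prodLift_fst]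
  change complexBetti.map (𝟙 A.X) 1 x = x
  rw [complexBetti.map_id]
  rfl

/-- The section `(𝟙, 0) : A ⟶ A × B` kills `pr_B^* H¹(B)`: `(𝟙, 0)^* pr_B^* y = 0` (the zero
homomorphism acts by `0` on `H¹`, `complexBetti_map_zero_one`). [cite: LangeBirkenhake1992, §1.1 (p. 19)] -/
theorem map_inlSection_map_snd_one (y : complexBetti B.X 1) :
    complexBetti.map (AbelianVariety.prodLift (𝟙 A) (0 : A ⟶ B)).hom.hom.hom 1
        (complexBetti.map (AbelianVariety.snd A B).hom.hom.hom 1 y) = 0 := by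
  change singularCohomology.map ℂ ℂ _ 1 (singularCohomology.map ℂ ℂ _ 1 y) = 0
  rw [abelianVarietyHom_map_map_apply, AbelianVariety.prodLift_snd]
  change complexBetti.map (0 : A ⟶ B).hom.hom.hom 1 y = 0
  rw [complexBetti_map_zero_one]
  rfl

/-- The section `(0, 𝟙) : B ⟶ A × B` splits `pr_B^*` on `H¹`. [folklore] -/
theorem map_inrSection_map_snd_one (y : complexBetti B.X 1) :
    complexBetti.map (AbelianVariety.prodLift (0 : B ⟶ A) (𝟙 B)).hom.hom.hom 1
        (complexBetti.map (AbelianVariety.snd A B).hom.hom.hom 1 y) = y := by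
  change singularCohomology.map ℂ ℂ _ 1 (singularCohomology.map ℂ ℂ _ 1 y) = y
  rw [abelianVarietyHom_map_map_apply, AbelianVariety.prodLift_snd]
  change complexBetti.map (𝟙 B.X) 1 y = y
  rw [complexBetti.map_id]
  rfl

/-- The section `(0, 𝟙) : B ⟶ A × B` kills `pr_A^* H¹(A)`. [cite: LangeBirkenhake1992, §1.1 (p. 19)] -/
theorem map_inrSection_map_fst_one (x : complexBetti A.X 1) :
    complexBetti.map (AbelianVariety.prodLift (0 : B ⟶ A) (𝟙 B)).hom.hom.hom 1
        (complexBetti.map (AbelianVariety.fst A B).hom.hom.hom 1 x) = 0 := by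
  change singularCohomology.map ℂ ℂ _ 1 (singularCohomology.map ℂ ℂ _ 1 x) = 0
  rw [abelianVarietyHom_map_map_apply, AbelianVariety.prodLift_fst]
  change complexBetti.map (0 : B ⟶ A).hom.hom.hom 1 x = 0
  rw [complexBetti_map_zero_one]
  rfl

/-- **Künneth frame in degree one**: pulling back `ℂ`-linearly independent families
`u : ι_A → H¹(A(ℂ))`, `w : ι_B → H¹(B(ℂ))` to `A × B` gives a `ℂ`-linearly independent family
`(pr_A^* uᵢ)_i ⊔ (pr_B^* w_k)_k` (the two sections `(𝟙,0)`, `(0,𝟙)` separate the summands;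
Hatcher Thm. 3.16 in degree one). [cite: HatcherAT2002, §3.2 Thm. 3.16] -/
theorem linearIndependent_sumElim_map_fst_map_snd {ιA ιB : Type*} {u : ιA → complexBetti A.X 1}
    {w : ιB → complexBetti B.X 1} (hu : LinearIndependent ℂ u) (hw : LinearIndependent ℂ w) :
    LinearIndependent ℂ (Sum.elim (fun i => complexBetti.map (AbelianVariety.fst A B).hom.hom.hom 1 (u i))
      (fun k => complexBetti.map (AbelianVariety.snd A B).hom.hom.hom 1 (w k))) := by
  refine LinearIndependent.sum_type ?_ ?_ ?_
  · refine LinearIndependent.of_comp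
      (complexBetti.map (AbelianVariety.prodLift (𝟙 A) (0 : A ⟶ B)).hom.hom.hom 1).hom ?_
    have e : ((complexBetti.map (AbelianVariety.prodLift (𝟙 A) (0 : A ⟶ B)).hom.hom.hom 1).hom ∘
        fun i => complexBetti.map (AbelianVariety.fst A B).hom.hom.hom 1 (u i)) = u :=
      funext fun i => map_inlSection_map_fst_one (u i)
    rw [e]
    exact hu
  · refine LinearIndependent.of_comp
      (complexBetti.map (AbelianVariety.prodLift (0 : B ⟶ A) (𝟙 B)).hom.hom.hom 1).hom ?_
    have e : ((complexBetti.map (AbelianVariety.prodLift (0 : B ⟶ A) (𝟙 B)).hom.hom.hom 1).hom ∘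
        fun k => complexBetti.map (AbelianVariety.snd A B).hom.hom.hom 1 (w k)) = w :=
      funext fun k => map_inrSection_map_snd_one (w k)
    rw [e]
    exact hw
  · rw [Submodule.disjoint_def]
    intro z hz hz'
    have hle : Submodule.span ℂ (Set.range fun i => complexBetti.map (AbelianVariety.fst A B).hom.hom.hom 1 (u i)) ≤
        LinearMap.range (complexBetti.map (AbelianVariety.fst A B).hom.hom.hom 1).hom :=
      Submodule.span_le.2 (Set.range_subset_iff.2 fun i => ⟨u i, rfl⟩)
    have hle' : Submodule.span ℂ (Set.range fun k => complexBetti.map (AbelianVariety.snd A B).hom.hom.hom 1 (w k)) ≤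
        LinearMap.range (complexBetti.map (AbelianVariety.snd A B).hom.hom.hom 1).hom :=
      Submodule.span_le.2 (Set.range_subset_iff.2 fun k => ⟨w k, rfl⟩)
    obtain ⟨a, rfl⟩ := hle hz
    obtain ⟨c, hc⟩ := hle' hz'
    have h1 := congrArg (complexBetti.map (AbelianVariety.prodLift (0 : B ⟶ A) (𝟙 B)).hom.hom.hom 1) hc
    change complexBetti.map _ 1 (complexBetti.map (AbelianVariety.snd A B).hom.hom.hom 1 c) =
      complexBetti.map _ 1 (complexBetti.map (AbelianVariety.fst A B).hom.hom.hom 1 a) at h1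
    rw [map_inrSection_map_snd_one, map_inrSection_map_fst_one] at h1
    change complexBetti.map (AbelianVariety.snd A B).hom.hom.hom 1 c = _ at hc
    rw [← hc, h1, map_zero]

variable (φ : A ⟶ A) (ψ : B ⟶ B)

/-- The product endomorphism `φ × ψ` acts on `pr_A^* H¹(A)` through `φ`:
`(φ × ψ)^* pr_A^* x = pr_A^* φ^* x`. [folklore] -/
theorem map_prodLift_map_fst (k : ℕ) (x : complexBetti A.X k) :
    complexBetti.map (AbelianVariety.prodLift (AbelianVariety.fst A B ≫ φ)
        (AbelianVariety.snd A B ≫ ψ)).hom.hom.hom k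
        (complexBetti.map (AbelianVariety.fst A B).hom.hom.hom k x) =
      complexBetti.map (AbelianVariety.fst A B).hom.hom.hom k (complexBetti.map φ.hom.hom.hom k x) := by
  change singularCohomology.map ℂ ℂ _ k (singularCohomology.map ℂ ℂ _ k x) =
    singularCohomology.map ℂ ℂ _ k (singularCohomology.map ℂ ℂ _ k x)
  rw [abelianVarietyHom_map_map_apply, abelianVarietyHom_map_map_apply, AbelianVariety.prodLift_fst]

/-- The product endomorphism `φ × ψ` acts on `pr_B^* H¹(B)` through `ψ`. [folklore] -/
theorem map_prodLift_map_snd (k : ℕ) (y : complexBetti B.X k) :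
    complexBetti.map (AbelianVariety.prodLift (AbelianVariety.fst A B ≫ φ)
        (AbelianVariety.snd A B ≫ ψ)).hom.hom.hom k
        (complexBetti.map (AbelianVariety.snd A B).hom.hom.hom k y) =
      complexBetti.map (AbelianVariety.snd A B).hom.hom.hom k (complexBetti.map ψ.hom.hom.hom k y) := by
  change singularCohomology.map ℂ ℂ _ k (singularCohomology.map ℂ ℂ _ k y) =
    singularCohomology.map ℂ ℂ _ k (singularCohomology.map ℂ ℂ _ k y)
  rw [abelianVarietyHom_map_map_apply, abelianVarietyHom_map_map_apply, AbelianVariety.prodLift_snd]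

/-- Abelian varieties are smooth projective of their dimension (`isSmoothProjective_holds`), in the
typing `A.dim = m`. [cite: MumfordAV1970, §4 (ii) and §6 Application 1 (p. 62)] -/
theorem isSmoothProjective_of_dim_eq' {m : ℕ} (hA : A.dim = m) : Motives.IsSmoothProjective m A.X := by
  have h := Motives.AbelianVariety.isSmoothProjective_holds (A := A)
  rw [Motives.AbelianVariety.isSmoothProjective, hA] at h
  exact h

/-- **The hyperbolic frame of a product from frames of the factors** (the carrier core of the
aiming lemma of the product trick; van Geemen, LNM 1594, Lemma 5.2 (2)–(3) and 5.4: "`det H` is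
multiplicative, a form of signature `(N, N)` and discriminant `(-1)^N` is hyperbolic", read
through the dictionary `Q_h = h^{2N-1} ⌣ (· ⌣ ·)` of `Motives/HyperbolicWeilType`). Let `A`, `B` be
complex abelian varieties of dimensions `jA + 1`, `jB + 1` with endomorphisms `φ`, `ψ`, and
`2N = dim A + dim B`. Suppose given RATIONAL MODELS of degree one on both factors: rational,
`ℂ`-independent classes `u : ι_A → H¹(A(ℂ))`, `w : ι_B → H¹(B(ℂ))` with rational matrices `M_A`,
`M_B` of `φ^*`, `ψ^*`, classes `h_A ∈ H²(A(ℂ))`, `h_B ∈ H²(B(ℂ))` whose polarization pairings have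
rational Gram matrices `G_A`, `G_B` with respect to classes `ω_A ∈ H^{2 dim A}`, `ω_B ∈ H^{2 dim B}`
(`Q_{h_A}(uᵢ, uⱼ) = (G_A)ᵢⱼ ω_A`, `Q_{h_B}(w_k, w_l) = (G_B)_{kl} ω_B`) and top powers
`h_A^{dim A} = d_A ω_A`, `h_B^{dim B} = d_B ω_B` (`d_A, d_B ∈ ℚ`). IF the weighted orthogonal sum
`C(2N-1, jA)·d_B·G_A ⊕ C(2N-1, jA+1)·d_A·G_B` admits `2N` `ℚ`-independent coefficient vectors spanning
an `(M_A ⊕ M_B)`-stable, totally isotropic subspace, THEN `(A × B, φ × ψ)` is of hyperbolic Weil type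
in half-dimension `N` for the product class `pr_A^* h_A + pr_B^* h_B`: the pulled-back frame
`(pr_A^* uᵢ) ⊔ (pr_B^* w_k)` is rational and `ℂ`-independent (Künneth in degree one), `(φ × ψ)^*` has
matrix `M_A ⊕ M_B` in it, and its polarization pairing has exactly the displayed block Gram matrix
with respect to `ω = pr_A^* ω_A ⌣ pr_B^* ω_B` (file V: `polarizationPairingOne_add_map_map`, `…'`,
`…_mixed`); then `isHyperbolicWeilType_of_rationalModel`. [cite: vanGeemen1994HodgeAV, Lemma 5.2 (2)–(3) and 5.4 (5.4.1)] -/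
theorem isHyperbolicWeilType_prod_of_rationalModels {jA jB N : ℕ} (hAdim : A.dim = jA + 1)
    (hBdim : B.dim = jB + 1) (hN : 2 * N = jA + jB + 2)
    {ιA ιB : Type} [Fintype ιA] [Fintype ιB]
    (u : ιA → complexBetti A.X 1) (hu : ∀ i, IsRationalClass (u i)) (hui : LinearIndependent ℂ u)
    (MA : Matrix ιA ιA ℚ)
    (hMA : ∀ i, complexBetti.map φ.hom.hom.hom 1 (u i) = ∑ j, ((MA j i : ℚ) : ℂ) • u j)
    (w : ιB → complexBetti B.X 1) (hw : ∀ k, IsRationalClass (w k)) (hwi : LinearIndependent ℂ w)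
    (MB : Matrix ιB ιB ℚ)
    (hMB : ∀ k, complexBetti.map ψ.hom.hom.hom 1 (w k) = ∑ l, ((MB l k : ℚ) : ℂ) • w l)
    (hA2 : complexBetti A.X 2) (ωA : complexBetti A.X (2 + 2 * jA)) (GA : Matrix ιA ιA ℚ)
    (hGA : ∀ i j, Motives.polarizationPairingOne A.X hA2 jA (u i) (u j) = ((GA i j : ℚ) : ℂ) • ωA)
    (dA : ℚ) (hdA : lefschetzPow hA2 jA 2 hA2 = ((dA : ℚ) : ℂ) • ωA)
    (hB2 : complexBetti B.X 2) (ωB : complexBetti B.X (2 + 2 * jB)) (GB : Matrix ιB ιB ℚ)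
    (hGB : ∀ k l, Motives.polarizationPairingOne B.X hB2 jB (w k) (w l) = ((GB k l : ℚ) : ℂ) • ωB)
    (dB : ℚ) (hdB : lefschetzPow hB2 jB 2 hB2 = ((dB : ℚ) : ℂ) • ωB)
    (b : Fin (2 * N) → (ιA ⊕ ιB) → ℚ) (hb : LinearIndependent ℚ b)
    (hbM : ∀ k, ∃ c : Fin (2 * N) → ℚ, (Matrix.fromBlocks MA 0 0 MB).mulVec (b k) = ∑ l, c l • b l)
    (hbG : ∀ k l, ∑ s, ∑ t, b k s *
      (Matrix.fromBlocks ((((2 * N - 1).choose jA : ℚ) * dB) • GA) 0 0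
        ((((2 * N - 1).choose (jA + 1) : ℚ) * dA) • GB)) s t * b l t = 0) :
    Motives.IsHyperbolicWeilType (A.prod B)
      (AbelianVariety.prodLift (AbelianVariety.fst A B ≫ φ) (AbelianVariety.snd A B ≫ ψ)) N
      (complexBetti.map (AbelianVariety.fst A B).hom.hom.hom 2 hA2 +
        complexBetti.map (AbelianVariety.snd A B).hom.hom.hom 2 hB2) := by
  classical
  have hX : Motives.IsSmoothProjective (jA + 1) A.X := isSmoothProjective_of_dim_eq' hAdim
  have hY : Motives.IsSmoothProjective (jB + 1) B.X := isSmoothProjective_of_dim_eq' hBdim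
  have hm : 2 * N - 1 = jA + jB + 1 := by omega
  set f := (AbelianVariety.fst A B).hom.hom.hom with hf
  set g := (AbelianVariety.snd A B).hom.hom.hom with hg
  -- the pulled-back frame, its matrix, Gram matrix and reference top class
  set U : ιA ⊕ ιB → complexBetti (A.prod B).X 1 :=
    Sum.elim (fun i => complexBetti.map f 1 (u i)) (fun k => complexBetti.map g 1 (w k)) with hU
  set ω : complexBetti (A.prod B).X (2 + 2 * (2 * N - 1)) :=
    cupProduct (by omega : (2 + 2 * jA) + (2 + 2 * jB) = 2 + 2 * (2 * N - 1))
      (complexBetti.map f (2 + 2 * jA) ωA) (complexBetti.map g (2 + 2 * jB) ωB) with hω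
  refine isHyperbolicWeilType_of_rationalModel U ?_ ?_ (Matrix.fromBlocks MA 0 0 MB) ?_
    (Matrix.fromBlocks ((((2 * N - 1).choose jA : ℚ) * dB) • GA) 0 0
      ((((2 * N - 1).choose (jA + 1) : ℚ) * dA) • GB)) ω ?_ b hb hbM hbG
  · -- rationality
    rintro (i | k)
    · exact (hu i).map _
    · exact (hw k).map _
  · -- `ℂ`-independence (Künneth in degree one)
    exact linearIndependent_sumElim_map_fst_map_snd hui hwi
  · -- the matrix of `(φ × ψ)^*`
    rintro (i | k)
    · simp only [hU, Sum.elim_inl, Fintype.sum_sum_type, Matrix.fromBlocks_apply₁₁,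
        Matrix.fromBlocks_apply₂₁, Matrix.zero_apply, Rat.cast_zero, zero_smul,
        Finset.sum_const_zero, add_zero, Sum.elim_inr]
      rw [map_prodLift_map_fst, hMA, map_sum]
      simp only [map_smul]
      rfl
    · simp only [hU, Sum.elim_inr, Fintype.sum_sum_type, Matrix.fromBlocks_apply₁₂,
        Matrix.fromBlocks_apply₂₂, Matrix.zero_apply, Rat.cast_zero, zero_smul,
        Finset.sum_const_zero, zero_add, Sum.elim_inl]
      rw [map_prodLift_map_snd, hMB, map_sum]
      simp only [map_smul]
      rfl
  · -- the block Gram matrix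
    rintro (i | k) (j | l)
    · simp only [hU, Sum.elim_inl, Matrix.fromBlocks_apply₁₁, Matrix.smul_apply, smul_eq_mul]
      rw [polarizationPairingOne_add_map_map f g hX hY hA2 hB2 hm, hGA, hdB]
      simp only [map_smul, LinearMap.smul_apply, smul_smul]
      rw [hω]
      congr 1
      push_cast
      ring
    · simp only [hU, Sum.elim_inl, Sum.elim_inr, Matrix.fromBlocks_apply₁₂, Matrix.zero_apply,
        Rat.cast_zero, zero_smul]
      exact polarizationPairingOne_add_map_map_mixed f g hX hY hA2 hB2 hm (u i) (w l)
    · simp only [hU, Sum.elim_inl, Sum.elim_inr, Matrix.fromBlocks_apply₂₁, Matrix.zero_apply,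
        Rat.cast_zero, zero_smul]
      exact polarizationPairingOne_add_map_map_mixed' f g hX hY hA2 hB2 hm (u j) (w k)
    · simp only [hU, Sum.elim_inr, Matrix.fromBlocks_apply₂₂, Matrix.smul_apply, smul_eq_mul]
      rw [polarizationPairingOne_add_map_map' f g hX hY hA2 hB2 hm, hGB, hdA]
      simp only [map_smul, LinearMap.smul_apply, smul_smul]
      rw [hω]
      congr 1
      push_cast
      ring

end Frame

end Summit.HodgeConjecture.HodgeConjecture.Theorems

end
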